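import Summits.QuantumFields.GaugeBoot.PairTraceClasses
import Summits.QuantumFields.GaugeBoot.LoopEquationPairForm
import Summits.QuantumFields.GaugeBoot.LoopEquationInstances
import HarnessLib

/-!
# Gauge-boot rung-0 truncation, `D = 3`, `SU(3)`: the three equality rows ARE theorems of the torus theory

Cell `pub-gaugeboot` (HOME `run/shared/lean/pub/pub-gaugeboot/`), seat lean2 (task L1 lane: "instances for the
certificate's 𝓔"), the `SU(3)` twin of `Rung0D3LoopEquations.lean` (`SU(2)`).  HONEST FRAMING (page 1 of every file of this
cell): certified bounds on lattice expectations at STATED coupling, gauge group, dimension and torus size; NOT a mass gap,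
NOT a continuum limit, NOT a string tension, NOT large `N`; NOT Yang–Mills-summit-bearing (barriers
`FixedCouplingUltralocality`, `PerturbativeInvisibility`).  This file enters NO bound, NO certificate, NO index row and NO
`CERTIFIED` cell: it proves that the equality system `𝓔` (the three `eq_rows`) shared by the twelve rung-0 `SU(3)`, `D = 3`
problem files `certs/SU3-D3/rung0/beta-*.problem1.json` (rows B26–B37 of `CERTIFIED.md`; 21 variables, labels identical in
all twelve files) holds VERBATIM among the torus expectations of lattice `SU(3)` Yang–Mills on `(ℤ/L)^3` — the positivity
blocks (`H0`, `RR`, `II`), the inequality rows and the certificates are NOT touched here.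

Variables (the files' `labels`, letters `a b c` = `+e₀ +e₁ +e₂`, `A B C` = `−e₀ −e₁ −e₂`; standard coupling `β = β_std`,
tree coupling `β/3`, `1/λ_KZ24 = β/18`), WRITTEN OUT IN FULL (no definition, no notation; `w⟦C⟧` and `d⟦A, x, B⟧` below are only the docstrings' shorthand):
* `w⟦C⟧ = wilsonExpectation (fundamentalRep (Fin 3)) (β/3) (wordLoop (fundamentalRep (Fin 3)) 0 C)` — the single-loop
  variable `w[C] = ⟨(1/3) Re tr hol_0 C⟩` (labels 1–10; label 0 is the constant `1` = `w⟦[]⟧`, `W_nil`);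
* `d⟦A, x, B⟧ = (∫ tr ρ(hol_0 A) · tr ρ(hol_x B) dμ_{β/3}).re / 9` — the pair variable `d[A@0; B@t] = Re⟨W_A W_B⟩`
  (`W = tr/3` complex; labels 11–20, second base point `x = castZ t`).
The files' variables are ORBIT AVERAGES of these over translations ⋉ `B₃` and joint orientation reversal; every element of
that group preserves the torus expectation (`LoopClasses`, `PairTraceClasses`), so the average equals the expectation.

Content:
* identification lemmas `W_…` / `D_…`: each raw word / raw positioned pair produced by the single-link Schwinger–Dyson
  identity in real pair form (`LoopEquationPairForm.loopEquation_pairForm_su_three`) at the marked plaquette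
  `P = +0 +1 −0 −1` and at the spur word `+0 · Q · −0` (`Word.spurPlaquette 0 1`, `Q` the plaquette at `e₀` in the
  `(0, 1)` plane not through the marked link) is carried to the file's label by a `decide`-checked script — single loops
  by `LoopClasses.Word.canon` (hyperoctahedral moves at the origin, reversal, rotation, free reduction;
  `wilsonExpectation_wordLoop_canon`), pairs by `PairLoopClasses.PMove` scripts WITHOUT single reversals
  (`PairTraceClasses.integral_trace_mul_trace_eq_of_run_zero`; joint translation / axis permutation / reflection,
  per-component rotation and reduction) — the scripts were found by search (seat tool `su3canon.py`, HOME
  `pub-gaugeboot-lean2/ready/leqdata/bindZ/g22-state/`) and are CHECKED here by the kernel;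
* `sdRow_plaquette` (`L ≥ 3`, every real `β`) — `eq_rows[0]` ("G1 mm_row(plaquette, SU(3)) at lam_KZ24 = 18/beta_std"):
  `−β/18 + 8/9·w₁ − β/18·w₂ − β/9·w₃ + β/18·w₇ + β/18·w₉ + β/9·w₁₀ + β/18·d₁₂ − β/18·d₁₃ − β/18·d₁₅ + β/18·d₁₆ + β/9·d₁₉ − β/9·d₂₀ = 0`
  (at `β_std = 1` literally the printed row `{0: −1/18, 1: 8/9, 2: −1/18, 3: −1/9, 7: 1/18, 9: 1/18, 10: 1/9, 12: 1/18,
  13: −1/18, 15: −1/18, 16: 1/18, 19: 1/9, 20: −1/9}`; the other eleven files carry the same row with `1/18 ↦ β_std/18`);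
* `spurRow_raw` (`L ≥ 4`, every `β`) and `spurRow` (`β ≠ 0`) — `eq_rows[1]` ("G1 mm_row(spur word +x.Q.-x, SU(3))"),
  printed without the common factor `1/λ`: `w₂ + w₄ + 2w₅ − w₆ − w₇ − 2w₈ + d₁₁ − d₁₂ − d₁₄ + d₁₅ + 2d₁₇ − 2d₁₈ = 0`;
* `newtonRow` (every `L ≥ 1`, every `β`) — `eq_rows[2]` ("SU(3) trace relation", Cayley–Hamilton):
  `−2/3·w₁ − 1/3·w₉ + d₁₃ = 0` (`SU3KinematicalRows.su3_newton_row_plaquette`).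
The seat checked (tool `su3rung0_rowcheck.py`, same HOME folder) that these coefficient vectors are those of all twelve files.
Everything is `[folklore]` (Makeenko–Migdal / Kazakov–Zheng arXiv:2404.16925 loop equations on the lattice; lattice
symmetries; Cayley–Hamilton for `SU(3)`).
-/

noncomputable section

open MeasureTheory
open scoped Matrix ComplexConjugate
open Literature.MathematicalPhysics.QuantumFieldTheory
open Literature.MathematicalPhysics.QuantumLattice

namespace Summit.QuantumFields.GaugeBoot

namespace Rung0D3SU3

variable (β : ℝ) (L : ℕ) [NeZero L]

/-! ## Generic identification lemmas -/

/-- **Single loops**: a raw word carried to `v` by `decide`-checked moves with zero net displacement after the moves has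
the same torus expectation (`LoopClasses.wilsonExpectation_wordLoop_canon`). [folklore] -/
theorem W_eq_of_canon (w v : Word 3) (ms : List (Move 3)) (rev : Bool) (k₁ k₂ : ℕ)
    (h : Word.disp (Word.acts ms w) = 0 ∧ Word.canon ms rev k₁ k₂ w = v) :
    wilsonExpectation (d := 3) (L := L) (fundamentalRep (Fin 3)) (β / 3) (wordLoop (fundamentalRep (Fin 3)) (0 : Site 3 L) w) =
      wilsonExpectation (d := 3) (L := L) (fundamentalRep (Fin 3)) (β / 3) (wordLoop (fundamentalRep (Fin 3)) (0 : Site 3 L) v) := by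
  rw [← h.2]
  exact wilsonExpectation_wordLoop_canon (fundamentalRep (Fin 3)) (continuous_fundamentalRep (Fin 3)) _ _ _ _ _ _ h.1

/-- **Positioned pairs**: a raw pair of words read from the origin, carried by a `decide`-checked script WITHOUT single
reversals to `(+0 +1 −0 −1 @ 0, B' @ y)`, has the pair variable `d⟦+0 +1 −0 −1, castZ y, B'⟧`
(`PairTraceClasses.integral_trace_mul_trace_eq_of_run_zero`). [folklore] -/
theorem D_eq_of_run (A B : Word 3) (ms : List (PMove 3)) (y : Fin 3 → ℤ) (B' : Word 3)
    (h : PMove.closedAlong ms (⟨0, A⟩, ⟨0, B⟩) ∧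
      PMove.run ms (⟨0, A⟩, ⟨0, B⟩) = (⟨0, [.fwd 0, .fwd 1, .bwd 0, .bwd 1]⟩, ⟨y, B'⟩))
    (hj : ∀ m ∈ ms, m ≠ PMove.revL ∧ m ≠ PMove.revR) :
    (∫ U, (fundamentalRep (Fin 3) (wordHolonomy U (0 : Site 3 L) A)).trace * (fundamentalRep (Fin 3) (wordHolonomy U (0 : Site 3 L) B)).trace ∂(wilsonMeasure (d := 3) (L := L) (fundamentalRep (Fin 3)) (β / 3))).re / 9 =
      (∫ U, (fundamentalRep (Fin 3) (wordHolonomy U (0 : Site 3 L) ([.fwd 0, .fwd 1, .bwd 0, .bwd 1] : Word 3))).trace * (fundamentalRep (Fin 3) (wordHolonomy U (castZ y) B')).trace ∂(wilsonMeasure (d := 3) (L := L) (fundamentalRep (Fin 3)) (β / 3))).re / 9 := by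
  have h' := integral_trace_mul_trace_eq_of_run_zero (L := L) (fundamentalRep (Fin 3))
    (continuous_fundamentalRep (Fin 3)) (β / 3) ms A B ⟨0, [.fwd 0, .fwd 1, .bwd 0, .bwd 1]⟩ ⟨y, B'⟩ h hj
  simp only [castZ_zero] at h'
  rw [h']

/-- The same with the second label read from the origin (`y = 0`). [folklore] -/
theorem D_eq_of_run_origin (A B B' : Word 3) (ms : List (PMove 3))
    (h : PMove.closedAlong ms (⟨0, A⟩, ⟨0, B⟩) ∧
      PMove.run ms (⟨0, A⟩, ⟨0, B⟩) = (⟨0, [.fwd 0, .fwd 1, .bwd 0, .bwd 1]⟩, ⟨0, B'⟩))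
    (hj : ∀ m ∈ ms, m ≠ PMove.revL ∧ m ≠ PMove.revR) :
    (∫ U, (fundamentalRep (Fin 3) (wordHolonomy U (0 : Site 3 L) A)).trace * (fundamentalRep (Fin 3) (wordHolonomy U (0 : Site 3 L) B)).trace ∂(wilsonMeasure (d := 3) (L := L) (fundamentalRep (Fin 3)) (β / 3))).re / 9 =
      (∫ U, (fundamentalRep (Fin 3) (wordHolonomy U (0 : Site 3 L) ([.fwd 0, .fwd 1, .bwd 0, .bwd 1] : Word 3))).trace * (fundamentalRep (Fin 3) (wordHolonomy U (0 : Site 3 L) B')).trace ∂(wilsonMeasure (d := 3) (L := L) (fundamentalRep (Fin 3)) (β / 3))).re / 9 := by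
  rw [D_eq_of_run β L A B ms 0 B' h hj, castZ_zero]

/-- **Label 0 is the constant `1`**: `w⟦[]⟧ = 1`. [folklore] -/
theorem W_nil :
    wilsonExpectation (d := 3) (L := L) (fundamentalRep (Fin 3)) (β / 3) (wordLoop (fundamentalRep (Fin 3)) (0 : Site 3 L) ([] : Word 3)) = 1 := by
  haveI := isProbabilityMeasure_wilsonMeasure (d := 3) (L := L) (fundamentalRep (Fin 3))
    (continuous_fundamentalRep (Fin 3)) (β / 3)
  rw [wordLoop_nil (fundamentalRep (Fin 3)) (by norm_num) 0]
  simp [wilsonExpectation]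

/-- **The closing marked letter**: `D(w, []) = w(w)` (`Re E[tr hol w · tr 1]/9 = (1/3) Re E[tr hol w]`). [folklore] -/
theorem D_nil_right (v : Word 3) :
    (∫ U, (fundamentalRep (Fin 3) (wordHolonomy U (0 : Site 3 L) v)).trace * (fundamentalRep (Fin 3) (wordHolonomy U (0 : Site 3 L) ([] : Word 3))).trace ∂(wilsonMeasure (d := 3) (L := L) (fundamentalRep (Fin 3)) (β / 3))).re / 9 =
      wilsonExpectation (d := 3) (L := L) (fundamentalRep (Fin 3)) (β / 3) (wordLoop (fundamentalRep (Fin 3)) (0 : Site 3 L) v) := by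
  rw [integral_trace_mul_trace_comm (fundamentalRep (Fin 3))]
  exact re_integral_trace_nil_mul_trace_su_three (β / 3) 0 v

/-! ## Identification of the raw terms with the labels (scripts found by search, checked by `decide`) -/

/-- `w`-identification: the raw word `abABabAB` is variable 9 `w[abABabAB]`. [folklore] -/
theorem W_plaq_1_true_P :
    wilsonExpectation (d := 3) (L := L) (fundamentalRep (Fin 3)) (β / 3) (wordLoop (fundamentalRep (Fin 3)) (0 : Site 3 L) (Word.plaquette (0 : Fin 3) 1 ++ plaqWord (0 : Fin 3) 1 true)) =
      wilsonExpectation (d := 3) (L := L) (fundamentalRep (Fin 3)) (β / 3) (wordLoop (fundamentalRep (Fin 3)) (0 : Site 3 L) ([.fwd 0, .fwd 1, .bwd 0, .bwd 1, .fwd 0, .fwd 1, .bwd 0, .bwd 1] : Word 3)) :=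
  W_eq_of_canon β L _ _ [] false 0 0 (by decide)
/-- `w`-identification: the raw word `abABbaBA` is variable 0 `1`. [folklore] -/
theorem W_plaq_1_true_Prev :
    wilsonExpectation (d := 3) (L := L) (fundamentalRep (Fin 3)) (β / 3) (wordLoop (fundamentalRep (Fin 3)) (0 : Site 3 L) (Word.plaquette (0 : Fin 3) 1 ++ Word.reverse (plaqWord (0 : Fin 3) 1 true))) =
      wilsonExpectation (d := 3) (L := L) (fundamentalRep (Fin 3)) (β / 3) (wordLoop (fundamentalRep (Fin 3)) (0 : Site 3 L) ([] : Word 3)) :=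
  W_eq_of_canon β L _ _ [] false 0 0 (by decide)
/-- `w`-identification: the raw word `abABaBAb` is variable 7 `w[abaBAbAB]`. [folklore] -/
theorem W_plaq_1_false_P :
    wilsonExpectation (d := 3) (L := L) (fundamentalRep (Fin 3)) (β / 3) (wordLoop (fundamentalRep (Fin 3)) (0 : Site 3 L) (Word.plaquette (0 : Fin 3) 1 ++ plaqWord (0 : Fin 3) 1 false)) =
      wilsonExpectation (d := 3) (L := L) (fundamentalRep (Fin 3)) (β / 3) (wordLoop (fundamentalRep (Fin 3)) (0 : Site 3 L) ([.fwd 0, .fwd 1, .fwd 0, .bwd 1, .bwd 0, .fwd 1, .bwd 0, .bwd 1] : Word 3)) :=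
  W_eq_of_canon β L _ _ [Move.perm (Equiv.swap 0 1)] false 0 7 (by decide)
/-- `w`-identification: the raw word `abABBabA` is variable 2 `w[aabAAB]`. [folklore] -/
theorem W_plaq_1_false_Prev :
    wilsonExpectation (d := 3) (L := L) (fundamentalRep (Fin 3)) (β / 3) (wordLoop (fundamentalRep (Fin 3)) (0 : Site 3 L) (Word.plaquette (0 : Fin 3) 1 ++ Word.reverse (plaqWord (0 : Fin 3) 1 false))) =
      wilsonExpectation (d := 3) (L := L) (fundamentalRep (Fin 3)) (β / 3) (wordLoop (fundamentalRep (Fin 3)) (0 : Site 3 L) ([.fwd 0, .fwd 0, .fwd 1, .bwd 0, .bwd 0, .bwd 1] : Word 3)) :=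
  W_eq_of_canon β L _ _ [Move.perm (Equiv.swap 0 1)] true 3 0 (by decide)
/-- `w`-identification: the raw word `abABacAC` is variable 10 `w[abABacAC]`. [folklore] -/
theorem W_plaq_2_true_P :
    wilsonExpectation (d := 3) (L := L) (fundamentalRep (Fin 3)) (β / 3) (wordLoop (fundamentalRep (Fin 3)) (0 : Site 3 L) (Word.plaquette (0 : Fin 3) 1 ++ plaqWord (0 : Fin 3) 2 true)) =
      wilsonExpectation (d := 3) (L := L) (fundamentalRep (Fin 3)) (β / 3) (wordLoop (fundamentalRep (Fin 3)) (0 : Site 3 L) ([.fwd 0, .fwd 1, .bwd 0, .bwd 1, .fwd 0, .fwd 2, .bwd 0, .bwd 2] : Word 3)) :=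
  W_eq_of_canon β L _ _ [] false 0 0 (by decide)
/-- `w`-identification: the raw word `abABcaCA` is variable 3 `w[abAcBC]`. [folklore] -/
theorem W_plaq_2_true_Prev :
    wilsonExpectation (d := 3) (L := L) (fundamentalRep (Fin 3)) (β / 3) (wordLoop (fundamentalRep (Fin 3)) (0 : Site 3 L) (Word.plaquette (0 : Fin 3) 1 ++ Word.reverse (plaqWord (0 : Fin 3) 2 true))) =
      wilsonExpectation (d := 3) (L := L) (fundamentalRep (Fin 3)) (β / 3) (wordLoop (fundamentalRep (Fin 3)) (0 : Site 3 L) ([.fwd 0, .fwd 1, .bwd 0, .fwd 2, .bwd 1, .bwd 2] : Word 3)) :=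
  W_eq_of_canon β L _ _ [Move.perm (Equiv.swap 0 1)] true 4 0 (by decide)
/-- `w`-identification: the raw word `abABaCAc` is variable 10 `w[abABacAC]`. [folklore] -/
theorem W_plaq_2_false_P :
    wilsonExpectation (d := 3) (L := L) (fundamentalRep (Fin 3)) (β / 3) (wordLoop (fundamentalRep (Fin 3)) (0 : Site 3 L) (Word.plaquette (0 : Fin 3) 1 ++ plaqWord (0 : Fin 3) 2 false)) =
      wilsonExpectation (d := 3) (L := L) (fundamentalRep (Fin 3)) (β / 3) (wordLoop (fundamentalRep (Fin 3)) (0 : Site 3 L) ([.fwd 0, .fwd 1, .bwd 0, .bwd 1, .fwd 0, .fwd 2, .bwd 0, .bwd 2] : Word 3)) :=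
  W_eq_of_canon β L _ _ [Move.refl 2] false 0 0 (by decide)
/-- `w`-identification: the raw word `abABCacA` is variable 3 `w[abAcBC]`. [folklore] -/
theorem W_plaq_2_false_Prev :
    wilsonExpectation (d := 3) (L := L) (fundamentalRep (Fin 3)) (β / 3) (wordLoop (fundamentalRep (Fin 3)) (0 : Site 3 L) (Word.plaquette (0 : Fin 3) 1 ++ Word.reverse (plaqWord (0 : Fin 3) 2 false))) =
      wilsonExpectation (d := 3) (L := L) (fundamentalRep (Fin 3)) (β / 3) (wordLoop (fundamentalRep (Fin 3)) (0 : Site 3 L) ([.fwd 0, .fwd 1, .bwd 0, .fwd 2, .bwd 1, .bwd 2] : Word 3)) :=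
  W_eq_of_canon β L _ _ [Move.refl 2, Move.perm (Equiv.swap 0 1)] true 4 0 (by decide)
/-- `w`-identification: the raw word `aabABAabAB` is variable 2 `w[aabAAB]`. [folklore] -/
theorem W_spur_1_true_P :
    wilsonExpectation (d := 3) (L := L) (fundamentalRep (Fin 3)) (β / 3) (wordLoop (fundamentalRep (Fin 3)) (0 : Site 3 L) (Word.spurPlaquette (0 : Fin 3) 1 ++ plaqWord (0 : Fin 3) 1 true)) =
      wilsonExpectation (d := 3) (L := L) (fundamentalRep (Fin 3)) (β / 3) (wordLoop (fundamentalRep (Fin 3)) (0 : Site 3 L) ([.fwd 0, .fwd 0, .fwd 1, .bwd 0, .bwd 0, .bwd 1] : Word 3)) :=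
  W_eq_of_canon β L _ _ [] false 0 0 (by decide)
/-- `w`-identification: the raw word `aabABAbaBA` is variable 7 `w[abaBAbAB]`. [folklore] -/
theorem W_spur_1_true_Prev :
    wilsonExpectation (d := 3) (L := L) (fundamentalRep (Fin 3)) (β / 3) (wordLoop (fundamentalRep (Fin 3)) (0 : Site 3 L) (Word.spurPlaquette (0 : Fin 3) 1 ++ Word.reverse (plaqWord (0 : Fin 3) 1 true))) =
      wilsonExpectation (d := 3) (L := L) (fundamentalRep (Fin 3)) (β / 3) (wordLoop (fundamentalRep (Fin 3)) (0 : Site 3 L) ([.fwd 0, .fwd 1, .fwd 0, .bwd 1, .bwd 0, .fwd 1, .bwd 0, .bwd 1] : Word 3)) :=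
  W_eq_of_canon β L _ _ [] true 4 0 (by decide)
/-- `w`-identification: the raw word `aabABAaBAb` is variable 4 `w[aabABBAb]`. [folklore] -/
theorem W_spur_1_false_P :
    wilsonExpectation (d := 3) (L := L) (fundamentalRep (Fin 3)) (β / 3) (wordLoop (fundamentalRep (Fin 3)) (0 : Site 3 L) (Word.spurPlaquette (0 : Fin 3) 1 ++ plaqWord (0 : Fin 3) 1 false)) =
      wilsonExpectation (d := 3) (L := L) (fundamentalRep (Fin 3)) (β / 3) (wordLoop (fundamentalRep (Fin 3)) (0 : Site 3 L) ([.fwd 0, .fwd 0, .fwd 1, .bwd 0, .bwd 1, .bwd 1, .bwd 0, .fwd 1] : Word 3)) :=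
  W_eq_of_canon β L _ _ [] false 0 0 (by decide)
/-- `w`-identification: the raw word `aabABABabA` is variable 6 `w[ababABAB]`. [folklore] -/
theorem W_spur_1_false_Prev :
    wilsonExpectation (d := 3) (L := L) (fundamentalRep (Fin 3)) (β / 3) (wordLoop (fundamentalRep (Fin 3)) (0 : Site 3 L) (Word.spurPlaquette (0 : Fin 3) 1 ++ Word.reverse (plaqWord (0 : Fin 3) 1 false))) =
      wilsonExpectation (d := 3) (L := L) (fundamentalRep (Fin 3)) (β / 3) (wordLoop (fundamentalRep (Fin 3)) (0 : Site 3 L) ([.fwd 0, .fwd 1, .fwd 0, .fwd 1, .bwd 0, .bwd 1, .bwd 0, .bwd 1] : Word 3)) :=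
  W_eq_of_canon β L _ _ [] false 7 0 (by decide)
/-- `w`-identification: the raw word `aabABAacAC` is variable 5 `w[aabABcAC]`. [folklore] -/
theorem W_spur_2_true_P :
    wilsonExpectation (d := 3) (L := L) (fundamentalRep (Fin 3)) (β / 3) (wordLoop (fundamentalRep (Fin 3)) (0 : Site 3 L) (Word.spurPlaquette (0 : Fin 3) 1 ++ plaqWord (0 : Fin 3) 2 true)) =
      wilsonExpectation (d := 3) (L := L) (fundamentalRep (Fin 3)) (β / 3) (wordLoop (fundamentalRep (Fin 3)) (0 : Site 3 L) ([.fwd 0, .fwd 0, .fwd 1, .bwd 0, .bwd 1, .fwd 2, .bwd 0, .bwd 2] : Word 3)) :=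
  W_eq_of_canon β L _ _ [] false 0 0 (by decide)
/-- `w`-identification: the raw word `aabABAcaCA` is variable 8 `w[abaBAcAC]`. [folklore] -/
theorem W_spur_2_true_Prev :
    wilsonExpectation (d := 3) (L := L) (fundamentalRep (Fin 3)) (β / 3) (wordLoop (fundamentalRep (Fin 3)) (0 : Site 3 L) (Word.spurPlaquette (0 : Fin 3) 1 ++ Word.reverse (plaqWord (0 : Fin 3) 2 true))) =
      wilsonExpectation (d := 3) (L := L) (fundamentalRep (Fin 3)) (β / 3) (wordLoop (fundamentalRep (Fin 3)) (0 : Site 3 L) ([.fwd 0, .fwd 1, .fwd 0, .bwd 1, .bwd 0, .fwd 2, .bwd 0, .bwd 2] : Word 3)) :=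
  W_eq_of_canon β L _ _ [] true 4 0 (by decide)
/-- `w`-identification: the raw word `aabABAaCAc` is variable 5 `w[aabABcAC]`. [folklore] -/
theorem W_spur_2_false_P :
    wilsonExpectation (d := 3) (L := L) (fundamentalRep (Fin 3)) (β / 3) (wordLoop (fundamentalRep (Fin 3)) (0 : Site 3 L) (Word.spurPlaquette (0 : Fin 3) 1 ++ plaqWord (0 : Fin 3) 2 false)) =
      wilsonExpectation (d := 3) (L := L) (fundamentalRep (Fin 3)) (β / 3) (wordLoop (fundamentalRep (Fin 3)) (0 : Site 3 L) ([.fwd 0, .fwd 0, .fwd 1, .bwd 0, .bwd 1, .fwd 2, .bwd 0, .bwd 2] : Word 3)) :=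
  W_eq_of_canon β L _ _ [Move.refl 2] false 0 0 (by decide)
/-- `w`-identification: the raw word `aabABACacA` is variable 8 `w[abaBAcAC]`. [folklore] -/
theorem W_spur_2_false_Prev :
    wilsonExpectation (d := 3) (L := L) (fundamentalRep (Fin 3)) (β / 3) (wordLoop (fundamentalRep (Fin 3)) (0 : Site 3 L) (Word.spurPlaquette (0 : Fin 3) 1 ++ Word.reverse (plaqWord (0 : Fin 3) 2 false))) =
      wilsonExpectation (d := 3) (L := L) (fundamentalRep (Fin 3)) (β / 3) (wordLoop (fundamentalRep (Fin 3)) (0 : Site 3 L) ([.fwd 0, .fwd 1, .fwd 0, .bwd 1, .bwd 0, .fwd 2, .bwd 0, .bwd 2] : Word 3)) :=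
  W_eq_of_canon β L _ _ [Move.refl 2] true 4 0 (by decide)
/-- `w`-identification: the spur word itself `aabABA` is variable 1 `w[abAB]` (backtrack). [folklore] -/
theorem W_spur_self :
    wilsonExpectation (d := 3) (L := L) (fundamentalRep (Fin 3)) (β / 3) (wordLoop (fundamentalRep (Fin 3)) (0 : Site 3 L) (Word.spurPlaquette (0 : Fin 3) 1)) =
      wilsonExpectation (d := 3) (L := L) (fundamentalRep (Fin 3)) (β / 3) (wordLoop (fundamentalRep (Fin 3)) (0 : Site 3 L) ([.fwd 0, .fwd 1, .bwd 0, .bwd 1] : Word 3)) :=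
  W_eq_of_canon β L _ _ [] false 1 0 (by decide)
/-- `w`-identification: the plaquette word in label letters (variable 1 `w[abAB]`). [folklore] -/
theorem W_plaq_self :
    wilsonExpectation (d := 3) (L := L) (fundamentalRep (Fin 3)) (β / 3) (wordLoop (fundamentalRep (Fin 3)) (0 : Site 3 L) (Word.plaquette (0 : Fin 3) 1)) =
      wilsonExpectation (d := 3) (L := L) (fundamentalRep (Fin 3)) (β / 3) (wordLoop (fundamentalRep (Fin 3)) (0 : Site 3 L) ([.fwd 0, .fwd 1, .bwd 0, .bwd 1] : Word 3)) :=
  W_eq_of_canon β L _ _ [] false 0 0 (by decide)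
/-- `d`-identification: the raw pair `(abAB@0, abAB@0)` is variable 13 `d[abAB@0,0,0;abAB@0,0,0]`. [folklore] -/
theorem D_plaq_1_true_P :
    (∫ U, (fundamentalRep (Fin 3) (wordHolonomy U (0 : Site 3 L) (Word.plaquette (0 : Fin 3) 1))).trace * (fundamentalRep (Fin 3) (wordHolonomy U (0 : Site 3 L) (plaqWord (0 : Fin 3) 1 true))).trace ∂(wilsonMeasure (d := 3) (L := L) (fundamentalRep (Fin 3)) (β / 3))).re / 9 =
      (∫ U, (fundamentalRep (Fin 3) (wordHolonomy U (0 : Site 3 L) ([.fwd 0, .fwd 1, .bwd 0, .bwd 1] : Word 3))).trace * (fundamentalRep (Fin 3) (wordHolonomy U (0 : Site 3 L) ([.fwd 0, .fwd 1, .bwd 0, .bwd 1] : Word 3))).trace ∂(wilsonMeasure (d := 3) (L := L) (fundamentalRep (Fin 3)) (β / 3))).re / 9 := by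
  exact D_eq_of_run_origin β L _ _ _ [] (by decide) (by simp)
/-- `d`-identification: the raw pair `(abAB@0, baBA@0)` is variable 16 `d[abAB@0,0,0;aBAb@0,1,0]`. [folklore] -/
theorem D_plaq_1_true_Prev :
    (∫ U, (fundamentalRep (Fin 3) (wordHolonomy U (0 : Site 3 L) (Word.plaquette (0 : Fin 3) 1))).trace * (fundamentalRep (Fin 3) (wordHolonomy U (0 : Site 3 L) (Word.reverse (plaqWord (0 : Fin 3) 1 true)))).trace ∂(wilsonMeasure (d := 3) (L := L) (fundamentalRep (Fin 3)) (β / 3))).re / 9 =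
      (∫ U, (fundamentalRep (Fin 3) (wordHolonomy U (0 : Site 3 L) ([.fwd 0, .fwd 1, .bwd 0, .bwd 1] : Word 3))).trace * (fundamentalRep (Fin 3) (wordHolonomy U (castZ ![0, 1, 0]) ([.fwd 0, .bwd 1, .bwd 0, .fwd 1] : Word 3))).trace ∂(wilsonMeasure (d := 3) (L := L) (fundamentalRep (Fin 3)) (β / 3))).re / 9 := by
  exact D_eq_of_run β L _ _ [PMove.rotR] ![0, 1, 0] _ (by decide) (by simp)
/-- `d`-identification: the raw pair `(abAB@0, aBAb@0)` is variable 15 `d[abAB@0,0,0;aBAb@-1,1,0]`. [folklore] -/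
theorem D_plaq_1_false_P :
    (∫ U, (fundamentalRep (Fin 3) (wordHolonomy U (0 : Site 3 L) (Word.plaquette (0 : Fin 3) 1))).trace * (fundamentalRep (Fin 3) (wordHolonomy U (0 : Site 3 L) (plaqWord (0 : Fin 3) 1 false))).trace ∂(wilsonMeasure (d := 3) (L := L) (fundamentalRep (Fin 3)) (β / 3))).re / 9 =
      (∫ U, (fundamentalRep (Fin 3) (wordHolonomy U (0 : Site 3 L) ([.fwd 0, .fwd 1, .bwd 0, .bwd 1] : Word 3))).trace * (fundamentalRep (Fin 3) (wordHolonomy U (castZ ![-1, 1, 0]) ([.fwd 0, .bwd 1, .bwd 0, .fwd 1] : Word 3))).trace ∂(wilsonMeasure (d := 3) (L := L) (fundamentalRep (Fin 3)) (β / 3))).re / 9 := by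
  exact D_eq_of_run β L _ _ [PMove.refl0, PMove.perm (Equiv.swap 0 1), PMove.rotL, PMove.rotR, PMove.rotR, PMove.rotR, PMove.shift ![0, 1, 0]] ![-1, 1, 0] _ (by decide) (by simp)
/-- `d`-identification: the raw pair `(abAB@0, BabA@0)` is variable 12 `d[abAB@0,0,0;abAB@-1,0,0]`. [folklore] -/
theorem D_plaq_1_false_Prev :
    (∫ U, (fundamentalRep (Fin 3) (wordHolonomy U (0 : Site 3 L) (Word.plaquette (0 : Fin 3) 1))).trace * (fundamentalRep (Fin 3) (wordHolonomy U (0 : Site 3 L) (Word.reverse (plaqWord (0 : Fin 3) 1 false)))).trace ∂(wilsonMeasure (d := 3) (L := L) (fundamentalRep (Fin 3)) (β / 3))).re / 9 =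
      (∫ U, (fundamentalRep (Fin 3) (wordHolonomy U (0 : Site 3 L) ([.fwd 0, .fwd 1, .bwd 0, .bwd 1] : Word 3))).trace * (fundamentalRep (Fin 3) (wordHolonomy U (castZ ![-1, 0, 0]) ([.fwd 0, .fwd 1, .bwd 0, .bwd 1] : Word 3))).trace ∂(wilsonMeasure (d := 3) (L := L) (fundamentalRep (Fin 3)) (β / 3))).re / 9 := by
  exact D_eq_of_run β L _ _ [PMove.refl0, PMove.perm (Equiv.swap 0 1), PMove.rotL, PMove.rotR, PMove.rotR, PMove.shift ![0, 1, 0]] ![-1, 0, 0] _ (by decide) (by simp)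
/-- `d`-identification: the raw pair `(abAB@0, acAC@0)` is variable 20 `d[abAB@0,0,0;acAC@0,0,0]`. [folklore] -/
theorem D_plaq_2_true_P :
    (∫ U, (fundamentalRep (Fin 3) (wordHolonomy U (0 : Site 3 L) (Word.plaquette (0 : Fin 3) 1))).trace * (fundamentalRep (Fin 3) (wordHolonomy U (0 : Site 3 L) (plaqWord (0 : Fin 3) 2 true))).trace ∂(wilsonMeasure (d := 3) (L := L) (fundamentalRep (Fin 3)) (β / 3))).re / 9 =
      (∫ U, (fundamentalRep (Fin 3) (wordHolonomy U (0 : Site 3 L) ([.fwd 0, .fwd 1, .bwd 0, .bwd 1] : Word 3))).trace * (fundamentalRep (Fin 3) (wordHolonomy U (0 : Site 3 L) ([.fwd 0, .fwd 2, .bwd 0, .bwd 2] : Word 3))).trace ∂(wilsonMeasure (d := 3) (L := L) (fundamentalRep (Fin 3)) (β / 3))).re / 9 := by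
  exact D_eq_of_run_origin β L _ _ _ [] (by decide) (by simp)
/-- `d`-identification: the raw pair `(abAB@0, caCA@0)` is variable 19 `d[abAB@0,0,0;acAC@0,0,-1]`. [folklore] -/
theorem D_plaq_2_true_Prev :
    (∫ U, (fundamentalRep (Fin 3) (wordHolonomy U (0 : Site 3 L) (Word.plaquette (0 : Fin 3) 1))).trace * (fundamentalRep (Fin 3) (wordHolonomy U (0 : Site 3 L) (Word.reverse (plaqWord (0 : Fin 3) 2 true)))).trace ∂(wilsonMeasure (d := 3) (L := L) (fundamentalRep (Fin 3)) (β / 3))).re / 9 =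
      (∫ U, (fundamentalRep (Fin 3) (wordHolonomy U (0 : Site 3 L) ([.fwd 0, .fwd 1, .bwd 0, .bwd 1] : Word 3))).trace * (fundamentalRep (Fin 3) (wordHolonomy U (castZ ![0, 0, -1]) ([.fwd 0, .fwd 2, .bwd 0, .bwd 2] : Word 3))).trace ∂(wilsonMeasure (d := 3) (L := L) (fundamentalRep (Fin 3)) (β / 3))).re / 9 := by
  exact D_eq_of_run β L _ _ [PMove.perm (Equiv.swap 0 2), PMove.refl0, PMove.perm (Equiv.swap 0 2), PMove.rotR] ![0, 0, -1] _ (by decide) (by simp)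
/-- `d`-identification: the raw pair `(abAB@0, aCAc@0)` is variable 20 `d[abAB@0,0,0;acAC@0,0,0]`. [folklore] -/
theorem D_plaq_2_false_P :
    (∫ U, (fundamentalRep (Fin 3) (wordHolonomy U (0 : Site 3 L) (Word.plaquette (0 : Fin 3) 1))).trace * (fundamentalRep (Fin 3) (wordHolonomy U (0 : Site 3 L) (plaqWord (0 : Fin 3) 2 false))).trace ∂(wilsonMeasure (d := 3) (L := L) (fundamentalRep (Fin 3)) (β / 3))).re / 9 =
      (∫ U, (fundamentalRep (Fin 3) (wordHolonomy U (0 : Site 3 L) ([.fwd 0, .fwd 1, .bwd 0, .bwd 1] : Word 3))).trace * (fundamentalRep (Fin 3) (wordHolonomy U (0 : Site 3 L) ([.fwd 0, .fwd 2, .bwd 0, .bwd 2] : Word 3))).trace ∂(wilsonMeasure (d := 3) (L := L) (fundamentalRep (Fin 3)) (β / 3))).re / 9 := by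
  exact D_eq_of_run_origin β L _ _ _ [PMove.perm (Equiv.swap 0 2), PMove.refl0, PMove.perm (Equiv.swap 0 2)] (by decide) (by simp)
/-- `d`-identification: the raw pair `(abAB@0, CacA@0)` is variable 19 `d[abAB@0,0,0;acAC@0,0,-1]`. [folklore] -/
theorem D_plaq_2_false_Prev :
    (∫ U, (fundamentalRep (Fin 3) (wordHolonomy U (0 : Site 3 L) (Word.plaquette (0 : Fin 3) 1))).trace * (fundamentalRep (Fin 3) (wordHolonomy U (0 : Site 3 L) (Word.reverse (plaqWord (0 : Fin 3) 2 false)))).trace ∂(wilsonMeasure (d := 3) (L := L) (fundamentalRep (Fin 3)) (β / 3))).re / 9 =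
      (∫ U, (fundamentalRep (Fin 3) (wordHolonomy U (0 : Site 3 L) ([.fwd 0, .fwd 1, .bwd 0, .bwd 1] : Word 3))).trace * (fundamentalRep (Fin 3) (wordHolonomy U (castZ ![0, 0, -1]) ([.fwd 0, .fwd 2, .bwd 0, .bwd 2] : Word 3))).trace ∂(wilsonMeasure (d := 3) (L := L) (fundamentalRep (Fin 3)) (β / 3))).re / 9 := by
  exact D_eq_of_run β L _ _ [PMove.rotR] ![0, 0, -1] _ (by decide) (by simp)
/-- `d`-identification: the raw pair `(aabABA@0, abAB@0)` is variable 12 `d[abAB@0,0,0;abAB@-1,0,0]`. [folklore] -/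
theorem D_spur_1_true_P :
    (∫ U, (fundamentalRep (Fin 3) (wordHolonomy U (0 : Site 3 L) (Word.spurPlaquette (0 : Fin 3) 1))).trace * (fundamentalRep (Fin 3) (wordHolonomy U (0 : Site 3 L) (plaqWord (0 : Fin 3) 1 true))).trace ∂(wilsonMeasure (d := 3) (L := L) (fundamentalRep (Fin 3)) (β / 3))).re / 9 =
      (∫ U, (fundamentalRep (Fin 3) (wordHolonomy U (0 : Site 3 L) ([.fwd 0, .fwd 1, .bwd 0, .bwd 1] : Word 3))).trace * (fundamentalRep (Fin 3) (wordHolonomy U (castZ ![-1, 0, 0]) ([.fwd 0, .fwd 1, .bwd 0, .bwd 1] : Word 3))).trace ∂(wilsonMeasure (d := 3) (L := L) (fundamentalRep (Fin 3)) (β / 3))).re / 9 := by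
  exact D_eq_of_run β L _ _ [PMove.rotL, PMove.redL, PMove.shift ![-1, 0, 0]] ![-1, 0, 0] _ (by decide) (by simp)
/-- `d`-identification: the raw pair `(aabABA@0, baBA@0)` is variable 15 `d[abAB@0,0,0;aBAb@-1,1,0]`. [folklore] -/
theorem D_spur_1_true_Prev :
    (∫ U, (fundamentalRep (Fin 3) (wordHolonomy U (0 : Site 3 L) (Word.spurPlaquette (0 : Fin 3) 1))).trace * (fundamentalRep (Fin 3) (wordHolonomy U (0 : Site 3 L) (Word.reverse (plaqWord (0 : Fin 3) 1 true)))).trace ∂(wilsonMeasure (d := 3) (L := L) (fundamentalRep (Fin 3)) (β / 3))).re / 9 =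
      (∫ U, (fundamentalRep (Fin 3) (wordHolonomy U (0 : Site 3 L) ([.fwd 0, .fwd 1, .bwd 0, .bwd 1] : Word 3))).trace * (fundamentalRep (Fin 3) (wordHolonomy U (castZ ![-1, 1, 0]) ([.fwd 0, .bwd 1, .bwd 0, .fwd 1] : Word 3))).trace ∂(wilsonMeasure (d := 3) (L := L) (fundamentalRep (Fin 3)) (β / 3))).re / 9 := by
  exact D_eq_of_run β L _ _ [PMove.rotL, PMove.redL, PMove.rotR, PMove.shift ![-1, 0, 0]] ![-1, 1, 0] _ (by decide) (by simp)
/-- `d`-identification: the raw pair `(aabABA@0, aBAb@0)` is variable 14 `d[abAB@0,0,0;aBAb@-1,0,0]`. [folklore] -/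
theorem D_spur_1_false_P :
    (∫ U, (fundamentalRep (Fin 3) (wordHolonomy U (0 : Site 3 L) (Word.spurPlaquette (0 : Fin 3) 1))).trace * (fundamentalRep (Fin 3) (wordHolonomy U (0 : Site 3 L) (plaqWord (0 : Fin 3) 1 false))).trace ∂(wilsonMeasure (d := 3) (L := L) (fundamentalRep (Fin 3)) (β / 3))).re / 9 =
      (∫ U, (fundamentalRep (Fin 3) (wordHolonomy U (0 : Site 3 L) ([.fwd 0, .fwd 1, .bwd 0, .bwd 1] : Word 3))).trace * (fundamentalRep (Fin 3) (wordHolonomy U (castZ ![-1, 0, 0]) ([.fwd 0, .bwd 1, .bwd 0, .fwd 1] : Word 3))).trace ∂(wilsonMeasure (d := 3) (L := L) (fundamentalRep (Fin 3)) (β / 3))).re / 9 := by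
  exact D_eq_of_run β L _ _ [PMove.rotL, PMove.redL, PMove.shift ![-1, 0, 0]] ![-1, 0, 0] _ (by decide) (by simp)
/-- `d`-identification: the raw pair `(aabABA@0, BabA@0)` is variable 11 `d[abAB@0,0,0;abAB@-1,-1,0]`. [folklore] -/
theorem D_spur_1_false_Prev :
    (∫ U, (fundamentalRep (Fin 3) (wordHolonomy U (0 : Site 3 L) (Word.spurPlaquette (0 : Fin 3) 1))).trace * (fundamentalRep (Fin 3) (wordHolonomy U (0 : Site 3 L) (Word.reverse (plaqWord (0 : Fin 3) 1 false)))).trace ∂(wilsonMeasure (d := 3) (L := L) (fundamentalRep (Fin 3)) (β / 3))).re / 9 =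
      (∫ U, (fundamentalRep (Fin 3) (wordHolonomy U (0 : Site 3 L) ([.fwd 0, .fwd 1, .bwd 0, .bwd 1] : Word 3))).trace * (fundamentalRep (Fin 3) (wordHolonomy U (castZ ![-1, -1, 0]) ([.fwd 0, .fwd 1, .bwd 0, .bwd 1] : Word 3))).trace ∂(wilsonMeasure (d := 3) (L := L) (fundamentalRep (Fin 3)) (β / 3))).re / 9 := by
  exact D_eq_of_run β L _ _ [PMove.rotL, PMove.redL, PMove.rotR, PMove.shift ![-1, 0, 0]] ![-1, -1, 0] _ (by decide) (by simp)
/-- `d`-identification: the raw pair `(aabABA@0, acAC@0)` is variable 18 `d[abAB@0,0,0;acAC@-1,0,0]`. [folklore] -/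
theorem D_spur_2_true_P :
    (∫ U, (fundamentalRep (Fin 3) (wordHolonomy U (0 : Site 3 L) (Word.spurPlaquette (0 : Fin 3) 1))).trace * (fundamentalRep (Fin 3) (wordHolonomy U (0 : Site 3 L) (plaqWord (0 : Fin 3) 2 true))).trace ∂(wilsonMeasure (d := 3) (L := L) (fundamentalRep (Fin 3)) (β / 3))).re / 9 =
      (∫ U, (fundamentalRep (Fin 3) (wordHolonomy U (0 : Site 3 L) ([.fwd 0, .fwd 1, .bwd 0, .bwd 1] : Word 3))).trace * (fundamentalRep (Fin 3) (wordHolonomy U (castZ ![-1, 0, 0]) ([.fwd 0, .fwd 2, .bwd 0, .bwd 2] : Word 3))).trace ∂(wilsonMeasure (d := 3) (L := L) (fundamentalRep (Fin 3)) (β / 3))).re / 9 := by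
  exact D_eq_of_run β L _ _ [PMove.rotL, PMove.redL, PMove.shift ![-1, 0, 0]] ![-1, 0, 0] _ (by decide) (by simp)
/-- `d`-identification: the raw pair `(aabABA@0, caCA@0)` is variable 17 `d[abAB@0,0,0;acAC@-1,0,-1]`. [folklore] -/
theorem D_spur_2_true_Prev :
    (∫ U, (fundamentalRep (Fin 3) (wordHolonomy U (0 : Site 3 L) (Word.spurPlaquette (0 : Fin 3) 1))).trace * (fundamentalRep (Fin 3) (wordHolonomy U (0 : Site 3 L) (Word.reverse (plaqWord (0 : Fin 3) 2 true)))).trace ∂(wilsonMeasure (d := 3) (L := L) (fundamentalRep (Fin 3)) (β / 3))).re / 9 =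
      (∫ U, (fundamentalRep (Fin 3) (wordHolonomy U (0 : Site 3 L) ([.fwd 0, .fwd 1, .bwd 0, .bwd 1] : Word 3))).trace * (fundamentalRep (Fin 3) (wordHolonomy U (castZ ![-1, 0, -1]) ([.fwd 0, .fwd 2, .bwd 0, .bwd 2] : Word 3))).trace ∂(wilsonMeasure (d := 3) (L := L) (fundamentalRep (Fin 3)) (β / 3))).re / 9 := by
  exact D_eq_of_run β L _ _ [PMove.perm (Equiv.swap 0 2), PMove.refl0, PMove.perm (Equiv.swap 0 2), PMove.rotL, PMove.redL, PMove.rotR, PMove.shift ![-1, 0, 0]] ![-1, 0, -1] _ (by decide) (by simp)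
/-- `d`-identification: the raw pair `(aabABA@0, aCAc@0)` is variable 18 `d[abAB@0,0,0;acAC@-1,0,0]`. [folklore] -/
theorem D_spur_2_false_P :
    (∫ U, (fundamentalRep (Fin 3) (wordHolonomy U (0 : Site 3 L) (Word.spurPlaquette (0 : Fin 3) 1))).trace * (fundamentalRep (Fin 3) (wordHolonomy U (0 : Site 3 L) (plaqWord (0 : Fin 3) 2 false))).trace ∂(wilsonMeasure (d := 3) (L := L) (fundamentalRep (Fin 3)) (β / 3))).re / 9 =
      (∫ U, (fundamentalRep (Fin 3) (wordHolonomy U (0 : Site 3 L) ([.fwd 0, .fwd 1, .bwd 0, .bwd 1] : Word 3))).trace * (fundamentalRep (Fin 3) (wordHolonomy U (castZ ![-1, 0, 0]) ([.fwd 0, .fwd 2, .bwd 0, .bwd 2] : Word 3))).trace ∂(wilsonMeasure (d := 3) (L := L) (fundamentalRep (Fin 3)) (β / 3))).re / 9 := by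
  exact D_eq_of_run β L _ _ [PMove.perm (Equiv.swap 0 2), PMove.refl0, PMove.perm (Equiv.swap 0 2), PMove.rotL, PMove.redL, PMove.shift ![-1, 0, 0]] ![-1, 0, 0] _ (by decide) (by simp)
/-- `d`-identification: the raw pair `(aabABA@0, CacA@0)` is variable 17 `d[abAB@0,0,0;acAC@-1,0,-1]`. [folklore] -/
theorem D_spur_2_false_Prev :
    (∫ U, (fundamentalRep (Fin 3) (wordHolonomy U (0 : Site 3 L) (Word.spurPlaquette (0 : Fin 3) 1))).trace * (fundamentalRep (Fin 3) (wordHolonomy U (0 : Site 3 L) (Word.reverse (plaqWord (0 : Fin 3) 2 false)))).trace ∂(wilsonMeasure (d := 3) (L := L) (fundamentalRep (Fin 3)) (β / 3))).re / 9 =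
      (∫ U, (fundamentalRep (Fin 3) (wordHolonomy U (0 : Site 3 L) ([.fwd 0, .fwd 1, .bwd 0, .bwd 1] : Word 3))).trace * (fundamentalRep (Fin 3) (wordHolonomy U (castZ ![-1, 0, -1]) ([.fwd 0, .fwd 2, .bwd 0, .bwd 2] : Word 3))).trace ∂(wilsonMeasure (d := 3) (L := L) (fundamentalRep (Fin 3)) (β / 3))).re / 9 := by
  exact D_eq_of_run β L _ _ [PMove.rotL, PMove.redL, PMove.rotR, PMove.shift ![-1, 0, 0]] ![-1, 0, -1] _ (by decide) (by simp)

/-! ## The three equality rows -/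

/-- **`eq_rows[0]` — the single-link Schwinger–Dyson row of the marked plaquette, VERBATIM** (lattice `SU(3)` on
`(ℤ/L)^3`, every `L ≥ 3`, every real standard coupling `β`; at `β = 1` the printed coefficients
`{0: −1/18, 1: 8/9, 2: −1/18, 3: −1/9, 7: 1/18, 9: 1/18, 10: 1/9, 12: 1/18, 13: −1/18, 15: −1/18, 16: 1/18, 19: 1/9, 20: −1/9}`
of `certs/SU3-D3/rung0/beta-1-1.problem1.json`). [folklore] -/
theorem sdRow_plaquette (hL : 3 ≤ L) :
    -(β / 18) + 8 / 9 * wilsonExpectation (d := 3) (L := L) (fundamentalRep (Fin 3)) (β / 3) (wordLoop (fundamentalRep (Fin 3)) (0 : Site 3 L) ([.fwd 0, .fwd 1, .bwd 0, .bwd 1] : Word 3))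
      - β / 18 * wilsonExpectation (d := 3) (L := L) (fundamentalRep (Fin 3)) (β / 3) (wordLoop (fundamentalRep (Fin 3)) (0 : Site 3 L) ([.fwd 0, .fwd 0, .fwd 1, .bwd 0, .bwd 0, .bwd 1] : Word 3))
      - β / 9 * wilsonExpectation (d := 3) (L := L) (fundamentalRep (Fin 3)) (β / 3) (wordLoop (fundamentalRep (Fin 3)) (0 : Site 3 L) ([.fwd 0, .fwd 1, .bwd 0, .fwd 2, .bwd 1, .bwd 2] : Word 3))
      + β / 18 * wilsonExpectation (d := 3) (L := L) (fundamentalRep (Fin 3)) (β / 3) (wordLoop (fundamentalRep (Fin 3)) (0 : Site 3 L) ([.fwd 0, .fwd 1, .fwd 0, .bwd 1, .bwd 0, .fwd 1, .bwd 0, .bwd 1] : Word 3))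
      + β / 18 * wilsonExpectation (d := 3) (L := L) (fundamentalRep (Fin 3)) (β / 3) (wordLoop (fundamentalRep (Fin 3)) (0 : Site 3 L) ([.fwd 0, .fwd 1, .bwd 0, .bwd 1, .fwd 0, .fwd 1, .bwd 0, .bwd 1] : Word 3))
      + β / 9 * wilsonExpectation (d := 3) (L := L) (fundamentalRep (Fin 3)) (β / 3) (wordLoop (fundamentalRep (Fin 3)) (0 : Site 3 L) ([.fwd 0, .fwd 1, .bwd 0, .bwd 1, .fwd 0, .fwd 2, .bwd 0, .bwd 2] : Word 3))
      + β / 18 * (∫ U, (fundamentalRep (Fin 3) (wordHolonomy U (0 : Site 3 L) ([.fwd 0, .fwd 1, .bwd 0, .bwd 1] : Word 3))).trace * (fundamentalRep (Fin 3) (wordHolonomy U (castZ ![-1, 0, 0]) ([.fwd 0, .fwd 1, .bwd 0, .bwd 1] : Word 3))).trace ∂(wilsonMeasure (d := 3) (L := L) (fundamentalRep (Fin 3)) (β / 3))).re / 9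
      - β / 18 * (∫ U, (fundamentalRep (Fin 3) (wordHolonomy U (0 : Site 3 L) ([.fwd 0, .fwd 1, .bwd 0, .bwd 1] : Word 3))).trace * (fundamentalRep (Fin 3) (wordHolonomy U (0 : Site 3 L) ([.fwd 0, .fwd 1, .bwd 0, .bwd 1] : Word 3))).trace ∂(wilsonMeasure (d := 3) (L := L) (fundamentalRep (Fin 3)) (β / 3))).re / 9
      - β / 18 * (∫ U, (fundamentalRep (Fin 3) (wordHolonomy U (0 : Site 3 L) ([.fwd 0, .fwd 1, .bwd 0, .bwd 1] : Word 3))).trace * (fundamentalRep (Fin 3) (wordHolonomy U (castZ ![-1, 1, 0]) ([.fwd 0, .bwd 1, .bwd 0, .fwd 1] : Word 3))).trace ∂(wilsonMeasure (d := 3) (L := L) (fundamentalRep (Fin 3)) (β / 3))).re / 9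
      + β / 18 * (∫ U, (fundamentalRep (Fin 3) (wordHolonomy U (0 : Site 3 L) ([.fwd 0, .fwd 1, .bwd 0, .bwd 1] : Word 3))).trace * (fundamentalRep (Fin 3) (wordHolonomy U (castZ ![0, 1, 0]) ([.fwd 0, .bwd 1, .bwd 0, .fwd 1] : Word 3))).trace ∂(wilsonMeasure (d := 3) (L := L) (fundamentalRep (Fin 3)) (β / 3))).re / 9
      + β / 9 * (∫ U, (fundamentalRep (Fin 3) (wordHolonomy U (0 : Site 3 L) ([.fwd 0, .fwd 1, .bwd 0, .bwd 1] : Word 3))).trace * (fundamentalRep (Fin 3) (wordHolonomy U (castZ ![0, 0, -1]) ([.fwd 0, .fwd 2, .bwd 0, .bwd 2] : Word 3))).trace ∂(wilsonMeasure (d := 3) (L := L) (fundamentalRep (Fin 3)) (β / 3))).re / 9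
      - β / 9 * (∫ U, (fundamentalRep (Fin 3) (wordHolonomy U (0 : Site 3 L) ([.fwd 0, .fwd 1, .bwd 0, .bwd 1] : Word 3))).trace * (fundamentalRep (Fin 3) (wordHolonomy U (0 : Site 3 L) ([.fwd 0, .fwd 2, .bwd 0, .bwd 2] : Word 3))).trace ∂(wilsonMeasure (d := 3) (L := L) (fundamentalRep (Fin 3)) (β / 3))).re / 9
      = 0 := by
  have h := loopEquation_pairForm_su_three_plaquette (L := L) (β / 3) (0 : Site 3 L) hL
  rw [univ_erase_zero_fin_three, Finset.sum_pair (by decide)] at h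
  simp only [Fintype.sum_bool, W_plaq_self, W_plaq_1_true_P, W_plaq_1_true_Prev, W_plaq_1_false_P,
    W_plaq_1_false_Prev, W_plaq_2_true_P, W_plaq_2_true_Prev, W_plaq_2_false_P, W_plaq_2_false_Prev, D_plaq_1_true_P,
    D_plaq_1_true_Prev, D_plaq_1_false_P, D_plaq_1_false_Prev, D_plaq_2_true_P, D_plaq_2_true_Prev, D_plaq_2_false_P,
    D_plaq_2_false_Prev, W_nil] at h
  linear_combination h

/-- **`eq_rows[1]` with its factor `1/λ = β/18` — the spur row** `+0 · Q · −0` (every `L ≥ 4`, every real `β`): the two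
traversals of the marked link cancel (`D([], w) = D(w, []) = w(w)`), the plaquette insertions remain. [folklore] -/
theorem spurRow_raw (hL : 4 ≤ L) :
    β / 18 * (wilsonExpectation (d := 3) (L := L) (fundamentalRep (Fin 3)) (β / 3) (wordLoop (fundamentalRep (Fin 3)) (0 : Site 3 L) ([.fwd 0, .fwd 0, .fwd 1, .bwd 0, .bwd 0, .bwd 1] : Word 3))
      + wilsonExpectation (d := 3) (L := L) (fundamentalRep (Fin 3)) (β / 3) (wordLoop (fundamentalRep (Fin 3)) (0 : Site 3 L) ([.fwd 0, .fwd 0, .fwd 1, .bwd 0, .bwd 1, .bwd 1, .bwd 0, .fwd 1] : Word 3))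
      + 2 * wilsonExpectation (d := 3) (L := L) (fundamentalRep (Fin 3)) (β / 3) (wordLoop (fundamentalRep (Fin 3)) (0 : Site 3 L) ([.fwd 0, .fwd 0, .fwd 1, .bwd 0, .bwd 1, .fwd 2, .bwd 0, .bwd 2] : Word 3))
      - wilsonExpectation (d := 3) (L := L) (fundamentalRep (Fin 3)) (β / 3) (wordLoop (fundamentalRep (Fin 3)) (0 : Site 3 L) ([.fwd 0, .fwd 1, .fwd 0, .fwd 1, .bwd 0, .bwd 1, .bwd 0, .bwd 1] : Word 3))
      - wilsonExpectation (d := 3) (L := L) (fundamentalRep (Fin 3)) (β / 3) (wordLoop (fundamentalRep (Fin 3)) (0 : Site 3 L) ([.fwd 0, .fwd 1, .fwd 0, .bwd 1, .bwd 0, .fwd 1, .bwd 0, .bwd 1] : Word 3))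
      - 2 * wilsonExpectation (d := 3) (L := L) (fundamentalRep (Fin 3)) (β / 3) (wordLoop (fundamentalRep (Fin 3)) (0 : Site 3 L) ([.fwd 0, .fwd 1, .fwd 0, .bwd 1, .bwd 0, .fwd 2, .bwd 0, .bwd 2] : Word 3))
      + (∫ U, (fundamentalRep (Fin 3) (wordHolonomy U (0 : Site 3 L) ([.fwd 0, .fwd 1, .bwd 0, .bwd 1] : Word 3))).trace * (fundamentalRep (Fin 3) (wordHolonomy U (castZ ![-1, -1, 0]) ([.fwd 0, .fwd 1, .bwd 0, .bwd 1] : Word 3))).trace ∂(wilsonMeasure (d := 3) (L := L) (fundamentalRep (Fin 3)) (β / 3))).re / 9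
      - (∫ U, (fundamentalRep (Fin 3) (wordHolonomy U (0 : Site 3 L) ([.fwd 0, .fwd 1, .bwd 0, .bwd 1] : Word 3))).trace * (fundamentalRep (Fin 3) (wordHolonomy U (castZ ![-1, 0, 0]) ([.fwd 0, .fwd 1, .bwd 0, .bwd 1] : Word 3))).trace ∂(wilsonMeasure (d := 3) (L := L) (fundamentalRep (Fin 3)) (β / 3))).re / 9
      - (∫ U, (fundamentalRep (Fin 3) (wordHolonomy U (0 : Site 3 L) ([.fwd 0, .fwd 1, .bwd 0, .bwd 1] : Word 3))).trace * (fundamentalRep (Fin 3) (wordHolonomy U (castZ ![-1, 0, 0]) ([.fwd 0, .bwd 1, .bwd 0, .fwd 1] : Word 3))).trace ∂(wilsonMeasure (d := 3) (L := L) (fundamentalRep (Fin 3)) (β / 3))).re / 9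
      + (∫ U, (fundamentalRep (Fin 3) (wordHolonomy U (0 : Site 3 L) ([.fwd 0, .fwd 1, .bwd 0, .bwd 1] : Word 3))).trace * (fundamentalRep (Fin 3) (wordHolonomy U (castZ ![-1, 1, 0]) ([.fwd 0, .bwd 1, .bwd 0, .fwd 1] : Word 3))).trace ∂(wilsonMeasure (d := 3) (L := L) (fundamentalRep (Fin 3)) (β / 3))).re / 9
      + 2 * (∫ U, (fundamentalRep (Fin 3) (wordHolonomy U (0 : Site 3 L) ([.fwd 0, .fwd 1, .bwd 0, .bwd 1] : Word 3))).trace * (fundamentalRep (Fin 3) (wordHolonomy U (castZ ![-1, 0, -1]) ([.fwd 0, .fwd 2, .bwd 0, .bwd 2] : Word 3))).trace ∂(wilsonMeasure (d := 3) (L := L) (fundamentalRep (Fin 3)) (β / 3))).re / 9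
      - 2 * (∫ U, (fundamentalRep (Fin 3) (wordHolonomy U (0 : Site 3 L) ([.fwd 0, .fwd 1, .bwd 0, .bwd 1] : Word 3))).trace * (fundamentalRep (Fin 3) (wordHolonomy U (castZ ![-1, 0, 0]) ([.fwd 0, .fwd 2, .bwd 0, .bwd 2] : Word 3))).trace ∂(wilsonMeasure (d := 3) (L := L) (fundamentalRep (Fin 3)) (β / 3))).re / 9)
      = 0 := by
  have hocc : ((Finset.range 6).filter ((Word.spurPlaquette (0 : Fin 3) 1).fwdOccZ 0)) = {0} ∧
      ((Finset.range 6).filter ((Word.spurPlaquette (0 : Fin 3) 1).bwdOccZ 0)) = {5} ∧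
      (Word.spurPlaquette (0 : Fin 3) 1).DispBound 2 ∧ Word.disp (Word.spurPlaquette (0 : Fin 3) 1) = 0 ∧
      (Word.spurPlaquette (0 : Fin 3) 1).take (5 + 1) = Word.spurPlaquette 0 1 ∧
      (Word.spurPlaquette (0 : Fin 3) 1).drop (5 + 1) = [] := by decide
  have h := loopEquation_pairForm_su_three (L := L) (β / 3) (0 : Site 3 L) 0 (Word.spurPlaquette (0 : Fin 3) 1)
    (Word.endpoint_eq_self_of_disp _ hocc.2.2.2.1) (Word.small_of_dispBound hocc.2.2.1 (by omega))
  rw [Word.length_spurPlaquette, hocc.1, hocc.2.1, Finset.sum_singleton, Finset.sum_singleton, List.take_zero,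
    List.drop_zero, hocc.2.2.2.2.1, hocc.2.2.2.2.2, re_integral_trace_nil_mul_trace_su_three, D_nil_right,
    univ_erase_zero_fin_three, Finset.sum_pair (by decide)] at h
  simp only [Fintype.sum_bool, W_spur_self, W_spur_1_true_P, W_spur_1_true_Prev, W_spur_1_false_P,
    W_spur_1_false_Prev, W_spur_2_true_P, W_spur_2_true_Prev, W_spur_2_false_P, W_spur_2_false_Prev, D_spur_1_true_P,
    D_spur_1_true_Prev, D_spur_1_false_P, D_spur_1_false_Prev, D_spur_2_true_P, D_spur_2_true_Prev, D_spur_2_false_P,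
    D_spur_2_false_Prev] at h
  linear_combination h

/-- **`eq_rows[1]` VERBATIM** (`β ≠ 0`, `L ≥ 4`; printed coefficients
`{2: 1, 4: 1, 5: 2, 6: −1, 7: −1, 8: −2, 11: 1, 12: −1, 14: −1, 15: 1, 17: 2, 18: −2}` of every
`certs/SU3-D3/rung0/beta-*.problem1.json`). [folklore] -/
theorem spurRow (hβ : β ≠ 0) (hL : 4 ≤ L) :
    wilsonExpectation (d := 3) (L := L) (fundamentalRep (Fin 3)) (β / 3) (wordLoop (fundamentalRep (Fin 3)) (0 : Site 3 L) ([.fwd 0, .fwd 0, .fwd 1, .bwd 0, .bwd 0, .bwd 1] : Word 3))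
      + wilsonExpectation (d := 3) (L := L) (fundamentalRep (Fin 3)) (β / 3) (wordLoop (fundamentalRep (Fin 3)) (0 : Site 3 L) ([.fwd 0, .fwd 0, .fwd 1, .bwd 0, .bwd 1, .bwd 1, .bwd 0, .fwd 1] : Word 3))
      + 2 * wilsonExpectation (d := 3) (L := L) (fundamentalRep (Fin 3)) (β / 3) (wordLoop (fundamentalRep (Fin 3)) (0 : Site 3 L) ([.fwd 0, .fwd 0, .fwd 1, .bwd 0, .bwd 1, .fwd 2, .bwd 0, .bwd 2] : Word 3))
      - wilsonExpectation (d := 3) (L := L) (fundamentalRep (Fin 3)) (β / 3) (wordLoop (fundamentalRep (Fin 3)) (0 : Site 3 L) ([.fwd 0, .fwd 1, .fwd 0, .fwd 1, .bwd 0, .bwd 1, .bwd 0, .bwd 1] : Word 3))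
      - wilsonExpectation (d := 3) (L := L) (fundamentalRep (Fin 3)) (β / 3) (wordLoop (fundamentalRep (Fin 3)) (0 : Site 3 L) ([.fwd 0, .fwd 1, .fwd 0, .bwd 1, .bwd 0, .fwd 1, .bwd 0, .bwd 1] : Word 3))
      - 2 * wilsonExpectation (d := 3) (L := L) (fundamentalRep (Fin 3)) (β / 3) (wordLoop (fundamentalRep (Fin 3)) (0 : Site 3 L) ([.fwd 0, .fwd 1, .fwd 0, .bwd 1, .bwd 0, .fwd 2, .bwd 0, .bwd 2] : Word 3))
      + (∫ U, (fundamentalRep (Fin 3) (wordHolonomy U (0 : Site 3 L) ([.fwd 0, .fwd 1, .bwd 0, .bwd 1] : Word 3))).trace * (fundamentalRep (Fin 3) (wordHolonomy U (castZ ![-1, -1, 0]) ([.fwd 0, .fwd 1, .bwd 0, .bwd 1] : Word 3))).trace ∂(wilsonMeasure (d := 3) (L := L) (fundamentalRep (Fin 3)) (β / 3))).re / 9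
      - (∫ U, (fundamentalRep (Fin 3) (wordHolonomy U (0 : Site 3 L) ([.fwd 0, .fwd 1, .bwd 0, .bwd 1] : Word 3))).trace * (fundamentalRep (Fin 3) (wordHolonomy U (castZ ![-1, 0, 0]) ([.fwd 0, .fwd 1, .bwd 0, .bwd 1] : Word 3))).trace ∂(wilsonMeasure (d := 3) (L := L) (fundamentalRep (Fin 3)) (β / 3))).re / 9
      - (∫ U, (fundamentalRep (Fin 3) (wordHolonomy U (0 : Site 3 L) ([.fwd 0, .fwd 1, .bwd 0, .bwd 1] : Word 3))).trace * (fundamentalRep (Fin 3) (wordHolonomy U (castZ ![-1, 0, 0]) ([.fwd 0, .bwd 1, .bwd 0, .fwd 1] : Word 3))).trace ∂(wilsonMeasure (d := 3) (L := L) (fundamentalRep (Fin 3)) (β / 3))).re / 9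
      + (∫ U, (fundamentalRep (Fin 3) (wordHolonomy U (0 : Site 3 L) ([.fwd 0, .fwd 1, .bwd 0, .bwd 1] : Word 3))).trace * (fundamentalRep (Fin 3) (wordHolonomy U (castZ ![-1, 1, 0]) ([.fwd 0, .bwd 1, .bwd 0, .fwd 1] : Word 3))).trace ∂(wilsonMeasure (d := 3) (L := L) (fundamentalRep (Fin 3)) (β / 3))).re / 9
      + 2 * (∫ U, (fundamentalRep (Fin 3) (wordHolonomy U (0 : Site 3 L) ([.fwd 0, .fwd 1, .bwd 0, .bwd 1] : Word 3))).trace * (fundamentalRep (Fin 3) (wordHolonomy U (castZ ![-1, 0, -1]) ([.fwd 0, .fwd 2, .bwd 0, .bwd 2] : Word 3))).trace ∂(wilsonMeasure (d := 3) (L := L) (fundamentalRep (Fin 3)) (β / 3))).re / 9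
      - 2 * (∫ U, (fundamentalRep (Fin 3) (wordHolonomy U (0 : Site 3 L) ([.fwd 0, .fwd 1, .bwd 0, .bwd 1] : Word 3))).trace * (fundamentalRep (Fin 3) (wordHolonomy U (castZ ![-1, 0, 0]) ([.fwd 0, .fwd 2, .bwd 0, .bwd 2] : Word 3))).trace ∂(wilsonMeasure (d := 3) (L := L) (fundamentalRep (Fin 3)) (β / 3))).re / 9
      = 0 := by
  have h := spurRow_raw β L hL
  have h18 : β / 18 ≠ 0 := div_ne_zero hβ (by norm_num)
  have h' := (mul_eq_zero.1 h).resolve_left h18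
  linear_combination h'

/-- **`eq_rows[2]` VERBATIM — the Newton row** (`SU(3)` Cayley–Hamilton, every `L ≥ 1`, every real `β`; printed
coefficients `{1: −2/3, 9: −1/3, 13: 1}`): `−2/3·w[abAB] − 1/3·w[abABabAB] + d[abAB@0; abAB@0] = 0`
(`SU3KinematicalRows.su3_newton_row_plaquette`). [folklore] -/
theorem newtonRow :
    -(2 / 3) * wilsonExpectation (d := 3) (L := L) (fundamentalRep (Fin 3)) (β / 3) (wordLoop (fundamentalRep (Fin 3)) (0 : Site 3 L) ([.fwd 0, .fwd 1, .bwd 0, .bwd 1] : Word 3))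
      - 1 / 3 * wilsonExpectation (d := 3) (L := L) (fundamentalRep (Fin 3)) (β / 3) (wordLoop (fundamentalRep (Fin 3)) (0 : Site 3 L) ([.fwd 0, .fwd 1, .bwd 0, .bwd 1, .fwd 0, .fwd 1, .bwd 0, .bwd 1] : Word 3))
      + (∫ U, (fundamentalRep (Fin 3) (wordHolonomy U (0 : Site 3 L) ([.fwd 0, .fwd 1, .bwd 0, .bwd 1] : Word 3))).trace * (fundamentalRep (Fin 3) (wordHolonomy U (0 : Site 3 L) ([.fwd 0, .fwd 1, .bwd 0, .bwd 1] : Word 3))).trace ∂(wilsonMeasure (d := 3) (L := L) (fundamentalRep (Fin 3)) (β / 3))).re / 9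
      = 0 := by
  have h := su3_newton_row_plaquette (L := L) (β / 3) (0 : Site 3 L) (0 : Fin 3) 1
  simp only [Word.plaquette, List.cons_append, List.nil_append] at h
  linear_combination h

end Rung0D3SU3

end Summit.QuantumFields.GaugeBoot

end
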